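import Literature.NumberTheory.Sieve.SmoothZetaDecayChebyshev
import HarnessLib

/-!
# The decay sum of `ζ(s, y)` on a range of primes for `|t| ≤ 3`, and the summation of range/block bounds

Topic `Literature/NumberTheory/Sieve`; a PROVED tool file toward Hildebrand–Tenenbaum's saddle-point theorem
[HildebrandTenenbaum1986, Thm 1] without their Lemma 6 (no zero-free region). With
`W = Σ_{p ≤ y} p^{-σ}(1 - cos(t log p))` (`|ζ(σ+it, y)| ≤ ζ(σ, y) e^{-W}`, `norm_smoothZetaC_le_mul_exp_neg_decaySum`):

* `exists_rangeDecaySum_ge` — **the Chebyshev regime `0 < |t| ≤ 3`** on the range `(z e^{-Λ}, z]`,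
  `Λ = 4 + 1/(5|t|)`: there are absolute `c > 0`, `z₀` with
  `Σ_{z e^{-Λ} < p ≤ z} p^{-σ}(1 - cos(t log p)) ≥ c (z e^{-Λ})^{1-σ}/log z` for `z ≥ z₀`, `0 ≤ σ ≤ 1`, `Λ ≤ log z/2`
  — the tree's `exists_decaySum_ge_sqrt` (fixed range `(√y, y]`, `σ ≥ 3/5`) localised: by `exists_good_subinterval`
  the logarithmic window `[log z - Λ, log z]` contains an interval `[ℓ₀, ℓ₀ + 2]` all of whose points keep `t`-phase
  distance `≥ 1/10` from `2πℤ`, and the primes `e^{ℓ₀} < p ≤ e^{ℓ₀+2}` have `θ`-mass `≥ e^{ℓ₀}` (Chebyshev).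
* `sum_sdiff_chain_ge` — **summation over consecutive blocks**: if each block
  `(z e^{-(i+1)Λ}, z e^{-iΛ}]`, `i ≤ I`, carries `Σ g ≥ b_i`, then `Σ_{z e^{-(I+1)Λ} < p ≤ z} g ≥ Σ_{i ≤ I} b_i`
  (the blocks are disjoint); `geom_lower_bound` — `Σ_{i ≤ I} e^{-(i+1)a} ≥ e^{-a}(1 - e^{-(I+1)a})/a` (`a > 0`); and
  the packaged form `sum_blocks_rpow_ge`: block bounds `c (z e^{-(i+1)Λ})^{1-σ}/log z` (`i ≤ I`, `σ < 1`) sum to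
  `≥ c e^{-Λ(1-σ)} (z^{1-σ} - (z e^{-(I+1)Λ})^{1-σ})/(Λ (1-σ) log z)` — Hildebrand–Tenenbaum's
  `W ≫ (y^{1-α} - 1)/((1-α) log y) ≍ ū` shape ((3.7), proof of (3.16)), to be fed with the block bounds of
  `SmoothZetaDecayBlocks` (`Λ = 3`) and the range bound above.

## References

* [HildebrandTenenbaum1986] A. Hildebrand, G. Tenenbaum, Trans. AMS 296 (1986) 265–290, §3 Lemma 3 (3.7), Lemma 8
  (ii) and the proof of (3.16) (held: `paper:doi-10-1090-s0002-9947-1986-0837811-1`, pp. 273–276).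

## Tree / Mathlib

Tree: `exists_good_subinterval`, `cos_le_cos_of_forall_dist`, `exp_two_gt`, `theta_sub_theta_eq_sum_sdiff`
(`SmoothZetaDecayChebyshev`), `exists_theta_ge_linear` (`SmoothSaddlePointApprox`). Mathlib:
`Chebyshev.theta_le_log4_mul_x`, `geom_sum_eq`, `Finset.sdiff_union_sdiff_cancel`, `Real.exp_mul`.
-/

noncomputable section

open Real Finset Chebyshev

namespace Literature.NumberTheory.Sieve

/-! ### The Chebyshev regime on a range `(z e^{-Λ}, z]` -/

set_option maxHeartbeats 800000 in
/-- **Decay on a range, Chebyshev regime (`0 < |t| ≤ 3`).** There are absolute `c > 0`, `z₀` such that for all real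
`z ≥ z₀`, `0 ≤ σ ≤ 1` and `t ≠ 0` with `|t| ≤ 3` and `Λ := 4 + 1/(5|t|) ≤ log z/2`:
`Σ_{z e^{-Λ} < p ≤ z} p^{-σ}(1 - cos(t log p)) ≥ c · (z e^{-Λ})^{1-σ}/log z`.
The bad `log p` (with `t log p` within `1/10` of `2πℤ`) form `(1/(10|t|))`-neighbourhoods of `(2π/|t|)ℤ`, whose gaps
have length `(2π - 1/5)/|t| ≥ 2`; so `[log z - Λ, log z]` (of length `Λ = 2·2 + 2/(10|t|)`) contains a good
`[ℓ₀, ℓ₀ + 2]`, and the primes `e^{ℓ₀} < p ≤ e^{ℓ₀ + 2}` (`θ`-mass `≥ e^{ℓ₀} ≥ z e^{-Λ}`) give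
`≥ (1 - cos(1/10)) e^{-2} (z e^{-Λ})^{1-σ}/log z`. [cite: HildebrandTenenbaum1986, §3 Lemma 8 (ii)] -/
theorem exists_rangeDecaySum_ge :
    ∃ c : ℝ, 0 < c ∧ ∃ z₀ : ℝ, 0 < z₀ ∧ ∀ z : ℝ, z₀ ≤ z → ∀ σ : ℝ, 0 ≤ σ → σ ≤ 1 → ∀ t : ℝ, t ≠ 0 →
      |t| ≤ 3 → 4 + 1 / (5 * |t|) ≤ Real.log z / 2 →
        c * ((z * Real.exp (-(4 + 1 / (5 * |t|)))) ^ (1 - σ) / Real.log z) ≤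
          ∑ p ∈ Nat.primesLE ⌊z⌋₊ \ Nat.primesLE ⌊z * Real.exp (-(4 + 1 / (5 * |t|)))⌋₊,
            (p : ℝ) ^ (-σ) * (1 - Real.cos (t * Real.log p)) := by
  obtain ⟨c₁, hc₁, hθ⟩ := exists_theta_ge_linear
  set δ : ℝ := 1 - Real.cos (1 / 10) with hδ
  have hδ0 : 0 < δ := by
    have h := two_div_pi_sq_mul_sq_le_one_sub_cos (φ := 1 / 10)
      (by rw [abs_of_nonneg (by norm_num)]; linarith [Real.pi_gt_d2])
    have : 0 < 2 / Real.pi ^ 2 * (1 / 10 : ℝ) ^ 2 := by positivity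
    linarith
  set Z : ℝ := max (Real.exp 10) ((6 * c₁ + 1) ^ 2) with hZ
  refine ⟨δ * Real.exp (-2), by positivity, Z, lt_of_lt_of_le (Real.exp_pos 10) (le_max_left _ _),
    fun z hz σ hσ0 hσ1 t ht0 ht3 hΛ => ?_⟩
  have hz10 : Real.exp 10 ≤ z := le_trans (le_max_left _ _) hz
  have hz0 : 0 < z := lt_of_lt_of_le (Real.exp_pos _) hz10
  have hz1 : 1 < z := lt_of_lt_of_le (by have := Real.add_one_le_exp (10 : ℝ); linarith) hz10
  have hlogz : 10 ≤ Real.log z := by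
    have := Real.log_le_log (Real.exp_pos _) hz10; rwa [Real.log_exp] at this
  have hlogz0 : 0 < Real.log z := by linarith
  have hsqrt_z : 6 * c₁ + 1 ≤ z ^ (1 / 2 : ℝ) := by
    have h1 : (6 * c₁ + 1) ^ 2 ≤ z := le_trans (le_max_right _ _) hz
    have h2 := Real.rpow_le_rpow (by positivity) h1 (by norm_num : (0 : ℝ) ≤ 1 / 2)
    rwa [← Real.rpow_natCast, ← Real.rpow_mul (by positivity), show ((2 : ℕ) : ℝ) * (1 / 2) = 1 by
      norm_num, Real.rpow_one] at h2
  -- reduce to `t > 0`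
  wlog htpos : 0 < t generalizing t
  · have ht0' : t < 0 := lt_of_le_of_ne (le_of_not_gt htpos) ht0
    have h := this (-t) (neg_ne_zero.2 ht0) (by rwa [abs_neg]) (by rwa [abs_neg]) (by linarith)
    simpa [neg_mul, Real.cos_neg, abs_neg] using h
  rw [abs_of_pos htpos] at ht3 hΛ ⊢
  have hπ := Real.pi_gt_d2
  have hπ' := Real.pi_lt_d2
  set Λ : ℝ := 4 + 1 / (5 * t) with hΛdef
  set P : ℝ := 2 * Real.pi / t with hP
  set r : ℝ := (1 / 10) / t with hr
  have hP0 : 0 < P := by positivity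
  have hr0 : 0 ≤ r := by positivity
  have hgap : (2 : ℝ) ≤ P - 2 * r := by
    have heq : P - 2 * r = (2 * Real.pi - 1 / 5) / t := by rw [hP, hr]; field_simp; ring
    rw [heq, le_div_iff₀ htpos]
    nlinarith
  have hW : 2 * (2 : ℝ) + 2 * r ≤ Λ := by
    have : 2 * r = 1 / (5 * t) := by rw [hr]; field_simp; ring
    rw [hΛdef]; linarith
  obtain ⟨ℓ₀, hℓ₀A, hℓ₀W, hgood⟩ :=
    exists_good_subinterval (A := Real.log z - Λ) hP0 hr0 two_pos hgap hW
  -- the multiplicative interval `(a, b]`, `a = e^{ℓ₀}`, `b = e^{ℓ₀ + 2}`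
  set a : ℝ := Real.exp ℓ₀ with ha
  set b : ℝ := Real.exp (ℓ₀ + 2) with hb
  have ha0 : 0 < a := Real.exp_pos _
  have hab : a ≤ b := Real.exp_le_exp.2 (by linarith)
  have hb_eq : b = Real.exp 2 * a := by rw [hb, ha, ← Real.exp_add]; ring_nf
  have hbz : b ≤ z := by
    calc b ≤ Real.exp (Real.log z) := Real.exp_le_exp.2 (by linarith)
      _ = z := Real.exp_log hz0
  have hzΛ_eq : z * Real.exp (-Λ) = Real.exp (Real.log z - Λ) := by
    rw [Real.exp_sub, Real.exp_log hz0, Real.exp_neg]; ring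
  have ha_low : z * Real.exp (-Λ) ≤ a := by rw [hzΛ_eq, ha]; exact Real.exp_le_exp.2 hℓ₀A
  have ha_sqrt : z ^ (1 / 2 : ℝ) ≤ a := by
    calc z ^ (1 / 2 : ℝ) = Real.exp (Real.log z * (1 / 2)) := Real.rpow_def_of_pos hz0 _
      _ ≤ Real.exp ℓ₀ := Real.exp_le_exp.2 (by linarith)
  have ha_ge : 6 * c₁ + 1 ≤ a := le_trans hsqrt_z ha_sqrt
  -- `θ(b) - θ(a) ≥ a`
  have hmass : a ≤ θ b - θ a := by
    have h1 := hθ b (by linarith)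
    have h2 := theta_le_log4_mul_x ha0.le
    have hl2 := Real.log_two_gt_d9
    have hl4 : Real.log 4 ≤ 1.3863 := by
      have h : Real.log 4 = 2 * Real.log 2 := by
        rw [show (4 : ℝ) = 2 ^ 2 by norm_num, Real.log_pow]; push_cast; ring
      rw [h]; have := Real.log_two_lt_d9; linarith
    have he2 := exp_two_gt
    rw [hb_eq] at h1 ⊢
    nlinarith [Real.exp_pos 2]
  -- the sub-sum over the primes in `(a, b]`
  have hsub : Nat.primesLE ⌊b⌋₊ \ Nat.primesLE ⌊a⌋₊ ⊆ Nat.primesLE ⌊z⌋₊ \ Nat.primesLE ⌊z * Real.exp (-Λ)⌋₊ := by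
    intro p hp
    obtain ⟨hpb, hpa⟩ := Finset.mem_sdiff.1 hp
    obtain ⟨hple, hpp⟩ := Nat.mem_primesLE.1 hpb
    refine Finset.mem_sdiff.2 ⟨Nat.mem_primesLE.2 ⟨hple.trans (Nat.floor_le_floor hbz), hpp⟩, fun h => hpa ?_⟩
    obtain ⟨hple', -⟩ := Nat.mem_primesLE.1 h
    exact Nat.mem_primesLE.2 ⟨hple'.trans (Nat.floor_le_floor ha_low), hpp⟩
  have hterm : ∀ p ∈ Nat.primesLE ⌊b⌋₊ \ Nat.primesLE ⌊a⌋₊,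
      δ * b ^ (-σ) / Real.log z * Real.log p ≤ (p : ℝ) ^ (-σ) * (1 - Real.cos (t * Real.log p)) := by
    intro p hp
    obtain ⟨hpb, hpa⟩ := Finset.mem_sdiff.1 hp
    obtain ⟨hple, hpp⟩ := Nat.mem_primesLE.1 hpb
    have hp0 : (0 : ℝ) < p := by exact_mod_cast hpp.pos
    have hp1 : (1 : ℝ) ≤ p := by exact_mod_cast hpp.one_lt.le
    have hpb' : (p : ℝ) ≤ b := le_trans (by exact_mod_cast hple) (Nat.floor_le (by positivity))
    have hpa' : a < p := by
      have hnot : ¬ p ≤ ⌊a⌋₊ := fun h => hpa (Nat.mem_primesLE.2 ⟨h, hpp⟩)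
      push Not at hnot
      exact lt_of_lt_of_le (Nat.lt_floor_add_one a) (by exact_mod_cast hnot)
    have hlogp_mem : Real.log p ∈ Set.Icc ℓ₀ (ℓ₀ + 2) := by
      constructor
      · have := Real.log_le_log ha0 hpa'.le; rwa [ha, Real.log_exp] at this
      · have := Real.log_le_log hp0 hpb'; rwa [hb, Real.log_exp] at this
    have hdist : ∀ k : ℤ, 1 / 10 ≤ |t * Real.log p - k * (2 * Real.pi)| := by
      intro k
      have h := hgood (Real.log p) hlogp_mem k
      have heq : t * Real.log p - k * (2 * Real.pi) = t * (Real.log p - k * P) := by rw [hP]; field_simp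
      rw [heq, abs_mul, abs_of_pos htpos]
      calc (1 / 10 : ℝ) = t * r := by rw [hr]; field_simp
        _ ≤ t * |Real.log p - k * P| := mul_le_mul_of_nonneg_left h htpos.le
    have hcos : Real.cos (t * Real.log p) ≤ Real.cos (1 / 10) := cos_le_cos_of_forall_dist (by norm_num) hdist
    have hone : δ ≤ 1 - Real.cos (t * Real.log p) := by rw [hδ]; linarith
    have hpow : b ^ (-σ) ≤ (p : ℝ) ^ (-σ) := Real.rpow_le_rpow_of_nonpos hp0 hpb' (by linarith)
    have hlogp : Real.log p ≤ Real.log z := Real.log_le_log hp0 (le_trans hpb' hbz)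
    have hlogp0 : 0 ≤ Real.log p := Real.log_nonneg hp1
    have hbσ : 0 < b ^ (-σ) := Real.rpow_pos_of_pos (by positivity) _
    calc δ * b ^ (-σ) / Real.log z * Real.log p = (δ * b ^ (-σ)) * (Real.log p / Real.log z) := by
          field_simp
      _ ≤ (δ * b ^ (-σ)) * 1 := by
          refine mul_le_mul_of_nonneg_left ?_ (by positivity)
          rwa [div_le_one hlogz0]
      _ = b ^ (-σ) * δ := by ring
      _ ≤ (p : ℝ) ^ (-σ) * (1 - Real.cos (t * Real.log p)) :=
          mul_le_mul hpow hone hδ0.le (Real.rpow_nonneg hp0.le _)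
  have hnonneg : ∀ p ∈ Nat.primesLE ⌊z⌋₊ \ Nat.primesLE ⌊z * Real.exp (-Λ)⌋₊,
      0 ≤ (p : ℝ) ^ (-σ) * (1 - Real.cos (t * Real.log p)) := by
    intro p _
    exact mul_nonneg (Real.rpow_nonneg (Nat.cast_nonneg _) _) (by linarith [Real.cos_le_one (t * Real.log p)])
  have hbσ : 0 < b ^ (-σ) := Real.rpow_pos_of_pos (by positivity) _
  have hzΛ0 : 0 < z * Real.exp (-Λ) := by positivity
  calc δ * Real.exp (-2) * ((z * Real.exp (-Λ)) ^ (1 - σ) / Real.log z)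
      ≤ δ * b ^ (-σ) / Real.log z * a := by
        -- `e^{-2} (z e^{-Λ})^{1-σ} ≤ e^{-2} a^{1-σ} ≤ b^{-σ} a`
        have h1 : (z * Real.exp (-Λ)) ^ (1 - σ) ≤ a ^ (1 - σ) :=
          Real.rpow_le_rpow hzΛ0.le ha_low (by linarith)
        have h2 : Real.exp (-2) * a ^ (1 - σ) ≤ b ^ (-σ) * a := by
          have hsplit : a ^ (1 - σ) = a ^ (-σ) * a := by
            rw [show (1 : ℝ) - σ = -σ + 1 by ring, Real.rpow_add ha0, Real.rpow_one]
          have hbpow : b ^ (-σ) = Real.exp 2 ^ (-σ) * a ^ (-σ) := by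
            rw [hb_eq, Real.mul_rpow (Real.exp_pos 2).le ha0.le]
          have he : Real.exp (-2) ≤ Real.exp 2 ^ (-σ) := by
            rw [← Real.exp_mul]; exact Real.exp_le_exp.2 (by linarith)
          rw [hsplit, hbpow]
          have : 0 ≤ a ^ (-σ) * a := by positivity
          calc Real.exp (-2) * (a ^ (-σ) * a) ≤ Real.exp 2 ^ (-σ) * (a ^ (-σ) * a) :=
                mul_le_mul_of_nonneg_right he this
            _ = Real.exp 2 ^ (-σ) * a ^ (-σ) * a := by ring
        calc δ * Real.exp (-2) * ((z * Real.exp (-Λ)) ^ (1 - σ) / Real.log z)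
            = δ / Real.log z * (Real.exp (-2) * (z * Real.exp (-Λ)) ^ (1 - σ)) := by field_simp
          _ ≤ δ / Real.log z * (Real.exp (-2) * a ^ (1 - σ)) :=
              mul_le_mul_of_nonneg_left (mul_le_mul_of_nonneg_left h1 (Real.exp_pos _).le) (by positivity)
          _ ≤ δ / Real.log z * (b ^ (-σ) * a) := mul_le_mul_of_nonneg_left h2 (by positivity)
          _ = δ * b ^ (-σ) / Real.log z * a := by field_simp
    _ ≤ δ * b ^ (-σ) / Real.log z * (θ b - θ a) := mul_le_mul_of_nonneg_left hmass (by positivity)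
    _ = ∑ p ∈ Nat.primesLE ⌊b⌋₊ \ Nat.primesLE ⌊a⌋₊, δ * b ^ (-σ) / Real.log z * Real.log p := by
        rw [theta_sub_theta_eq_sum_sdiff hab, Finset.mul_sum]
    _ ≤ ∑ p ∈ Nat.primesLE ⌊b⌋₊ \ Nat.primesLE ⌊a⌋₊, (p : ℝ) ^ (-σ) * (1 - Real.cos (t * Real.log p)) :=
        Finset.sum_le_sum hterm
    _ ≤ _ := Finset.sum_le_sum_of_subset_of_nonneg hsub fun p hp _ => hnonneg p hp

/-! ### Summation over consecutive blocks -/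

/-- **Consecutive blocks are disjoint and fill the range.** For real `z > 0`, `Λ ≥ 0` and lower bounds
`b i ≤ Σ_{z e^{-(i+1)Λ} < p ≤ z e^{-iΛ}} g(p)` (`i ≤ I`):
`Σ_{i ≤ I} b i ≤ Σ_{z e^{-(I+1)Λ} < p ≤ z} g(p)`. [folklore] -/
theorem sum_sdiff_chain_ge {g : ℕ → ℝ} {z Λ : ℝ} (hz : 0 < z) (hΛ : 0 ≤ Λ) {b : ℕ → ℝ} (I : ℕ)
    (hblock : ∀ i : ℕ, i ≤ I → b i ≤
      ∑ p ∈ Nat.primesLE ⌊z * Real.exp (-(i * Λ))⌋₊ \ Nat.primesLE ⌊z * Real.exp (-((i + 1) * Λ))⌋₊, g p) :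
    ∑ i ∈ Finset.range (I + 1), b i ≤
      ∑ p ∈ Nat.primesLE ⌊z⌋₊ \ Nat.primesLE ⌊z * Real.exp (-((I + 1 : ℕ) * Λ))⌋₊, g p := by
  -- the endpoints `N i = ⌊z e^{-iΛ}⌋` are non-increasing
  set N : ℕ → ℕ := fun i => ⌊z * Real.exp (-(i * Λ))⌋₊ with hN
  have hN0 : N 0 = ⌊z⌋₊ := by simp [hN]
  have hNmono : ∀ i j : ℕ, i ≤ j → N j ≤ N i := by
    intro i j hij
    simp only [hN]
    refine Nat.floor_le_floor (mul_le_mul_of_nonneg_left (Real.exp_le_exp.2 ?_) hz.le)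
    have : (i : ℝ) * Λ ≤ j * Λ := mul_le_mul_of_nonneg_right (by exact_mod_cast hij) hΛ
    linarith
  have hcast : ∀ i : ℕ, ((i : ℝ) + 1) * Λ = ((i + 1 : ℕ) : ℝ) * Λ := fun i => by push_cast; ring
  -- induction on `I`
  induction I with
  | zero =>
    rw [Finset.sum_range_one]
    have h := hblock 0 le_rfl
    simp only [Nat.cast_zero, zero_mul, neg_zero, Real.exp_zero, mul_one, zero_add, one_mul] at h
    simpa using h
  | succ I ih =>
    have ih' := ih (fun i hi => hblock i (hi.trans (Nat.le_succ I)))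
    rw [Finset.sum_range_succ]
    have hlast := hblock (I + 1) le_rfl
    rw [hcast (I + 1)] at hlast
    -- split the big range into the range down to `N (I+1)` and the last block
    have hsub1 : Nat.primesLE (N (I + 1)) ⊆ Nat.primesLE ⌊z⌋₊ := by
      rw [← hN0]; exact Nat.primesLE_mono (hNmono 0 (I + 1) (Nat.zero_le _))
    have hsub2 : Nat.primesLE (N (I + 1 + 1)) ⊆ Nat.primesLE (N (I + 1)) :=
      Nat.primesLE_mono (hNmono (I + 1) (I + 1 + 1) (Nat.le_succ _))
    have hunion : Nat.primesLE ⌊z⌋₊ \ Nat.primesLE (N (I + 1 + 1)) =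
        (Nat.primesLE ⌊z⌋₊ \ Nat.primesLE (N (I + 1))) ∪ (Nat.primesLE (N (I + 1)) \ Nat.primesLE (N (I + 1 + 1))) :=
      (Finset.sdiff_union_sdiff_cancel hsub1 hsub2).symm
    have hdisj : Disjoint (Nat.primesLE ⌊z⌋₊ \ Nat.primesLE (N (I + 1)))
        (Nat.primesLE (N (I + 1)) \ Nat.primesLE (N (I + 1 + 1))) := by
      refine Finset.disjoint_left.2 fun p hp hp' => ?_
      exact (Finset.mem_sdiff.1 hp).2 (Finset.mem_sdiff.1 hp').1
    have hNI1 : N (I + 1) = ⌊z * Real.exp (-((I + 1 : ℕ) * Λ))⌋₊ := rfl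
    have hNI2 : N (I + 1 + 1) = ⌊z * Real.exp (-((I + 1 + 1 : ℕ) * Λ))⌋₊ := rfl
    rw [← hNI2, hunion, Finset.sum_union hdisj]
    rw [← hNI1] at ih'
    have hlast' : b (I + 1) ≤ ∑ p ∈ Nat.primesLE (N (I + 1)) \ Nat.primesLE (N (I + 1 + 1)), g p := by
      rw [hNI1, hNI2]; exact hlast
    linarith

/-- **Geometric lower bound**: for `a > 0`, `Σ_{i ≤ I} e^{-(i+1)a} ≥ e^{-a}(1 - e^{-(I+1)a})/a`
(`Σ = e^{-a}(1 - e^{-(I+1)a})/(1 - e^{-a})` and `1 - e^{-a} ≤ a`). [folklore] -/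
theorem geom_lower_bound {a : ℝ} (ha : 0 < a) (I : ℕ) :
    Real.exp (-a) * (1 - Real.exp (-((I + 1 : ℕ) * a))) / a ≤
      ∑ i ∈ Finset.range (I + 1), Real.exp (-((i + 1) * a)) := by
  set q : ℝ := Real.exp (-a) with hq
  have hq0 : 0 < q := Real.exp_pos _
  have hq1 : q < 1 := Real.exp_lt_one_iff.2 (by linarith)
  have hterm : ∀ i : ℕ, Real.exp (-((i + 1) * a)) = q * q ^ i := by
    intro i
    rw [hq, ← Real.exp_nat_mul, ← Real.exp_add]
    congr 1; ring
  have hsum : ∑ i ∈ Finset.range (I + 1), Real.exp (-((i + 1) * a)) = q * ((q ^ (I + 1) - 1) / (q - 1)) := by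
    rw [Finset.sum_congr rfl fun i _ => hterm i, ← Finset.mul_sum, geom_sum_eq hq1.ne]
  have hpow : Real.exp (-((I + 1 : ℕ) * a)) = q ^ (I + 1) := by
    rw [hq, ← Real.exp_nat_mul]; congr 1; ring
  rw [hsum, hpow]
  have h1a : 1 - q ≤ a := by
    have := Real.add_one_le_exp (-a); rw [← hq] at this; linarith
  have h1q : 0 < 1 - q := by linarith
  have hqI : q ^ (I + 1) ≤ 1 := pow_le_one₀ hq0.le hq1.le
  rw [show (q ^ (I + 1) - 1) / (q - 1) = (1 - q ^ (I + 1)) / (1 - q) by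
    rw [← neg_sub 1 (q ^ (I + 1)), ← neg_sub 1 q, neg_div_neg_eq]]
  rw [mul_div_assoc]
  refine le_trans (le_of_eq (by ring)) (mul_le_mul_of_nonneg_left
    (div_le_div_of_nonneg_left (by linarith) h1q h1a) hq0.le)

/-- **Summing block bounds of the shape `c (z e^{-(i+1)Λ})^{1-σ}/log z`.** For `z > 1`, `Λ > 0`, `σ < 1` and
block bounds `c (z e^{-(i+1)Λ})^{1-σ}/log z ≤ Σ_{z e^{-(i+1)Λ} < p ≤ z e^{-iΛ}} g` (`i ≤ I`, `c ≥ 0`):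
`c e^{-Λ(1-σ)} (z^{1-σ} - (z e^{-(I+1)Λ})^{1-σ})/(Λ (1-σ) log z) ≤ Σ_{z e^{-(I+1)Λ} < p ≤ z} g`.
[cite: HildebrandTenenbaum1986, §3 (3.7) and proof of (3.16)] -/
theorem sum_blocks_rpow_ge {g : ℕ → ℝ} {z Λ σ c : ℝ} (hz : 1 < z) (hΛ : 0 < Λ)
    (hσ : σ < 1) (hc : 0 ≤ c) (I : ℕ)
    (hblock : ∀ i : ℕ, i ≤ I → c * ((z * Real.exp (-((i + 1) * Λ))) ^ (1 - σ) / Real.log z) ≤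
      ∑ p ∈ Nat.primesLE ⌊z * Real.exp (-(i * Λ))⌋₊ \ Nat.primesLE ⌊z * Real.exp (-((i + 1) * Λ))⌋₊, g p) :
    c * Real.exp (-(Λ * (1 - σ))) * (z ^ (1 - σ) - (z * Real.exp (-((I + 1 : ℕ) * Λ))) ^ (1 - σ)) /
        (Λ * (1 - σ) * Real.log z) ≤
      ∑ p ∈ Nat.primesLE ⌊z⌋₊ \ Nat.primesLE ⌊z * Real.exp (-((I + 1 : ℕ) * Λ))⌋₊, g p := by
  have hz0 : 0 < z := by linarith
  have hlogz : 0 < Real.log z := Real.log_pos hz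
  have h1σ : 0 < 1 - σ := by linarith
  set a : ℝ := Λ * (1 - σ) with ha
  have ha0 : 0 < a := by positivity
  -- `(z e^{-(i+1)Λ})^{1-σ} = z^{1-σ} e^{-(i+1)a}`
  have hpow : ∀ s : ℝ, (z * Real.exp (-(s * Λ))) ^ (1 - σ) = z ^ (1 - σ) * Real.exp (-(s * a)) := by
    intro s
    rw [Real.mul_rpow hz0.le (Real.exp_pos _).le, ← Real.exp_mul, ha]
    congr 2; ring
  have hsum := sum_sdiff_chain_ge hz0 hΛ.le I
    (b := fun i => c * ((z * Real.exp (-((i + 1) * Λ))) ^ (1 - σ) / Real.log z)) hblock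
  refine le_trans ?_ hsum
  have hgeom := geom_lower_bound ha0 I
  have hrew : ∑ i ∈ Finset.range (I + 1), c * ((z * Real.exp (-((i + 1) * Λ))) ^ (1 - σ) / Real.log z) =
      c * z ^ (1 - σ) / Real.log z * ∑ i ∈ Finset.range (I + 1), Real.exp (-((i + 1) * a)) := by
    rw [Finset.mul_sum]
    refine Finset.sum_congr rfl fun i _ => ?_
    rw [hpow]; field_simp
  rw [hrew]
  have hI : (z * Real.exp (-((I + 1 : ℕ) * Λ))) ^ (1 - σ) = z ^ (1 - σ) * Real.exp (-((I + 1 : ℕ) * a)) := hpow _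
  rw [hI]
  have hzpow : 0 < z ^ (1 - σ) := Real.rpow_pos_of_pos hz0 _
  calc c * Real.exp (-a) * (z ^ (1 - σ) - z ^ (1 - σ) * Real.exp (-((I + 1 : ℕ) * a))) / (a * Real.log z)
      = c * z ^ (1 - σ) / Real.log z * (Real.exp (-a) * (1 - Real.exp (-((I + 1 : ℕ) * a))) / a) := by
        field_simp
    _ ≤ c * z ^ (1 - σ) / Real.log z * ∑ i ∈ Finset.range (I + 1), Real.exp (-((i + 1) * a)) :=
        mul_le_mul_of_nonneg_left hgeom (by positivity)

end Literature.NumberTheory.Sieve
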